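import Summits.BirchSwinnertonDyer.BirchSwinnertonDyer.Theorems.PrintCf2RamifiedOffTYZLowerHalfVisibleSeven
import HarnessLib

/-!
# Crux workfile (line `offtyz-v7`, crux stmt-BirchSwinnertonDyer-20509) — THE VISIBILITY LAWS OF THE FROZEN HALF, typed
# (LEAD cruxlead-20509 g16, cycle 17; CONJECTURES as `def … : Prop`, nothing asserted; companion of `Lines/offtyz_v7_Visibility.md` §8)

Census of this cycle (kit-free instruments `dclass_search.py`, `r1_visibility.py`, evidence on 20509): writing `h = (X_h, Y_h)` for a generator of
`A_n(ℚ)/tors` (`A_n : Y² = X³ + 4n²X`), `d(h) = [X_h]`, `γ_h = X_h + 2ni` (scaled to `ℤ[i]`), `α_n = Θ_A(h)`, `[α_n]` its class in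
`A(ℍ′_n)/(2A(ℍ′_n) + tors)`:
* R2 (`n = lm`, `l ≡ 1`, `m ≡ 7 (mod 8)`; block-free, `ℍ′_n = ℚ(i,√l,√m)`): `[α_n] ≠ 0 ⟺ d(h) ∉ {1, 2}` — THEOREM (p759700/p760160, mod displays);
  census n ≤ 2·10⁴: 18 of 24 decided jump-one special members have `d(h) ∈ {l, 2l}` (visible), 6 have `d(h) = 2`.
* R1 (`n = lm`, `l ≡ 1`, `m ≡ 5 (mod 8)`; blocks `m`, `lm`; `ℍ′_n = ℚ(i,√l,√m)·H′_m·H′_{lm}`): **`[α_n] = 0` for ALL 31 decided special members**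
  (29 G + 2 B; `γ_h` itself — never `iγ_h` — is a square modulo 25–72 primes splitting completely in `ℍ′_n`, 0 exceptions; for `ρ = 1` it is the
  proved valve `LevelTwoRhoValve`).  Conjecture `VisibilityLawR1` below: on R1 the frozen half is ALWAYS invisible, so g2's visibility door is
  void there and BOTH halves of C⁺ are depth-≥-2 statements on the whole R1 special stratum.
Reading (memo §8): `[α_n] = 0` iff the `D₄`-closure of `ℚ(i, √γ_h)` (cyclic quartic over `ℚ(√−e)`, `e = d(h)`, unramified outside `2lm∞`) is absorbed
by the ring class fields of the BLOCKS of `ℍ′_n`; on R1 the blocks `m, lm` are present and absorb it (a second-descent / Rédei-symbol identity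
behind g15's ρ-law `(l/m)₄ = (m/l)₄`, conjecturally), on the block-free family nothing can absorb it unless `d(h) = 2`.
BSD is not proved by any of this; nothing here is asserted; C⁺ = item 23431 and crux 20509 remain OPEN.
-/

noncomputable section

open scoped Classical

open WeierstrassCurve WeierstrassCurve.Affine Literature.NumberTheory.EllipticCurves
  Literature.NumberTheory.EllipticCurves.TianYuanZhang2017 Literature.NumberTheory.EllipticCurves.TianYuanZhang2017.W2

namespace Summit.BirchSwinnertonDyer.PrintCf2.VisibilityLaws

/-- The sector R1 of the k = 2 census: `n = l·m`, `l ≡ 1 (mod 8)`, `m ≡ 5 (mod 8)` primes, `(m/l) = +1` (so `#Sel₂(E_n) = 2⁵`).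
[cite: HeathBrown1994SelmerCongruentII, Appendix (Monsky)] -/
def SectorR1 (n l m : ℕ) : Prop :=
  n = l * m ∧ l.Prime ∧ m.Prime ∧ l % 8 = 1 ∧ m % 8 = 5 ∧ jacobiSym m l = 1

/-- **CONJECTURE (V-R1), census 31/31** — on R1 the frozen half is invisible: for every data `D` of the displays and every generator `h = (X, Y)`
of `A_n(ℚ)` modulo torsion with `X ∉ ℚ^{×2}` (i.e. `ρ(n) = 0`), the point `Θ_A(h)` IS `2`-divisible modulo torsion in `A(ℍ′_n)`.  (For `X ∈ ℚ^{×2}`,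
`ρ(n) = 1`, this is the proved valve.)  Support-grade research statement; a proof would be a second-descent / Rédei-field identity.
[cite: TianYuanZhang2017, §1 (p0002 L101–L110), §3.1 (p0011 L27–L36, L58–L66), Thm. 3.5] -/
def VisibilityLawR1 : Prop :=
  ∀ (n l m : ℕ) (hsq : Squarefree n), SectorR1 n l m →
    ∀ D : GenusPointData n, D.Printed → D.CMPointCompositumPrinted →
      ∀ (X Y : ℚ) (h : (Atwo n).toAffine.Nonsingular X Y),
        (∀ P : (Atwo n).toAffine.Point, ∃ k : ℤ, IsOfFinAddOrder (P - k • (Point.some X Y h : (Atwo n).toAffine.Point))) →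
        (¬ ∃ q : ℚ, X = q ^ 2) →
          ∃ y : APoint D.H, IsOfFinAddOrder
            (Point.map (W' := curveA) (D.embK n (Nat.mem_divisors_self n hsq.ne_zero)) (ΘA hsq.ne_zero (Point.some X Y h)) - (2 : ℤ) • y)

/-- **The block-free dichotomy as a single statement** (PROVED direction `→` of the first conjunct is p760160's content read through g2; the converse
«`d(h) = 2 ⟹ [α_n] = 0`» is the elementary computation `(1+i)γ_h ≡ u·r` of the memo §1, not yet typed as a kernel theorem): on the block-free family,
`[Θ_A(h)] = 0 ⟺ X_h ∈ ℚ^{×2} ∪ 2ℚ^{×2}`. [cite: TianYuanZhang2017, §3.1 (p0011 L58–L66), Thm. 3.5, Lemma 3.18] -/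
def BlockFreeDichotomy : Prop :=
  ∀ (n : ℕ) (hsq : Squarefree n), n % 8 = 7 → (∀ d ∈ n.divisors, d % 8 ≠ 5) →
    ∀ D : GenusPointData n, D.Printed → D.CMPointCompositumPrinted →
      ∀ (X Y : ℚ) (h : (Atwo n).toAffine.Nonsingular X Y),
        ((∃ y : APoint D.H, IsOfFinAddOrder
            (Point.map (W' := curveA) (D.embK n (Nat.mem_divisors_self n hsq.ne_zero)) (ΘA hsq.ne_zero (Point.some X Y h)) - (2 : ℤ) • y))
          ↔ ∃ q : ℚ, X = q ^ 2 ∨ X = 2 * q ^ 2)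

/-- The PROVED half of `BlockFreeDichotomy` (`→` fails ⟸ `X ∉ ℚ² ∪ 2ℚ²`): a restatement of `…VisibleGenerator` + `…LowerHalfVisible` §1–§2 plumbing.
[cite: TianYuanZhang2017, §3.1 (p0011 L58–L66), Lemma 3.18] -/
theorem not_twoDivisible_of_blockFree {n : ℕ} (hsq : Squarefree n) (h7 : n % 8 = 7) (hnb : ∀ d ∈ n.divisors, d % 8 ≠ 5)
    (D : GenusPointData n) (hPr : D.Printed) (hC : D.CMPointCompositumPrinted)
    {X Y : ℚ} (h : (Atwo n).toAffine.Nonsingular X Y) (hX : ¬ ∃ q : ℚ, X = q ^ 2 ∨ X = 2 * q ^ 2) :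
    ¬ ∃ y : APoint D.H, IsOfFinAddOrder
      (Point.map (W' := curveA) (D.embK n (Nat.mem_divisors_self n hsq.ne_zero)) (ΘA hsq.ne_zero (Point.some X Y h)) - (2 : ℤ) • y) := by
  have hn0 : n ≠ 0 := hsq.ne_zero
  have hodd : Odd n := Nat.odd_iff.mpr (by omega)
  have h318 : D.lemma318 := hPr.2.2.2.2.2.2.2.2.1
  obtain ⟨z, Φ, ΓH, ΓH', σ, θ, c, ρ₂, ρ₄, hconj, -, hcomp⟩ := hC
  have hnb' : ∀ d ∈ n.divisors, d % 8 ≠ 5 ∧ d % 8 ≠ 6 := by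
    intro d hd
    refine ⟨hnb d hd, fun h6 => ?_⟩
    obtain ⟨k, hk⟩ := hodd.of_dvd_nat (Nat.dvd_of_mem_divisors hd)
    omega
  have hcomm : ∀ g : D.H ≃ₐ[ℚ] D.H, g * c = c * g := fun g => hcomp.commute_of_noBlock hnb' g c
  obtain ⟨Y', hP, hmap⟩ := LowerHalfVisible.exists_map_ΘA_eq_some hsq D h
  rw [hmap]
  exact VisibleGenerator.not_twoDivisible_of_sq_add_four D hodd h318 c hconj.1 hconj.2.2 hcomm hP
    (LowerHalfVisible.not_sq_add_four_of_not_sq hn0 h hX)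

end Summit.BirchSwinnertonDyer.PrintCf2.VisibilityLaws

end
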